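import Literature.AnabelianGeometry.AbsoluteAnabelian.TateModuleRestrictionCompletion
import Literature.AnabelianGeometry.AbsoluteAnabelian.LocalReciprocityVerlagerung
import Literature.AnabelianGeometry.AbsoluteAnabelian.GaloisCyclotomeRestrictionIndex
import Literature.AnabelianGeometry.AbsoluteAnabelian.AbsTopIII.ReconstructionCor110iiPrimeProofs
import Literature.NumberTheory.GaloisRepresentations.TateDualityCounting
import HarnessLib

/-!
# [AbsTopIII] Cor. 1.10 (i)(b): functoriality in OPEN INJECTIONS — the restriction/Verlagerung square
# `j_E ∘ H¹(res; μ_Ẑ(res)) = Ver_{E/F} ∘ j_F`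

S. Mochizuki, *Topics in Absolute Anabelian Geometry III*, Cor. 1.10 (i) p. 42 (kurims
`paper:url-5493eb38cbb7`): «There exists a functorial "group-theoretic" algorithm for reconstructing … the
natural surjection `H¹(G_k, μ_Ẑ(G_k)) ⥲ G_k^ab ↠ Ẑ` … Here, the asserted "functoriality" is with respect to
arbitrary injective open homomorphisms of profinite groups [cf. also Remark 1.10.1, (iii), below].»

abc-iut cell, layer L4, row «COR110ib-OPEN» (abc-iut-L4-t11; L4-lead RULINGS #6g, #7b): after the
ISOMORPHISM case (reading (N), `AbsTopIII.cor_1_10_i_b_natural_holds`, abc-iut-L4-d3) an injective open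
`β : G_{k′} ↪ G_k` reduces to the FIELD-THEORETIC restriction `res : G_E ↪ G_F` along a finite extension
`E/F` of MLFs.  This proof-only file assembles the four squares for that restriction, for the members
`j_k = H¹(i_k) ≫ (H¹(G_k, Ẑ(1)) ≃ (kˣ)^∧) ≫ e_k` of the family (EXACTLY abc-iut-L4-d3's expression:
`i_k = galCyclotomeIsoTateModule k φ_k`, the Kummer–completion isomorphism of abc-iut-L4-t11, and a
topological isomorphism `e_k : (kˣ)^∧ ⥲ G_k^ab` extending the CANONICAL reciprocity map
`θ_k = (isReciprocitySystemE (F := k) (E := k) (isClassFieldTheory_localWeilDatum k)).theta`):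

* (S4) `toTateModule_galCyclotomeResCoeff`, `cohomologyMap_iso_galCyclotomeRes` — for cyclotome
  identifications `φ_F, φ_E` COMPATIBLE UNDER RESTRICTION (`φ_E ∘ μ_{ℚ/ℤ}(res)⁻¹ = ι ∘ φ_F`; e.g. `φ_E`
  the identification INDUCED from `φ_F`, abc-iut-w5-d201's `inducedCyclotomeEquiv`, as in the (O4) index
  formula `GaloisCyclotomeRestrictionIndex.lean`), abc-iut-w5-d201's restriction `galCyclotomeRes F E 1`
  (`GaloisCyclotomeRestriction.lean`: Mathlib `ContinuousCohomology.map res` with coefficients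
  `μ_Ẑ(G_F)|_{G_E} ⥲ μ_Ẑ(G_E)`) becomes, under `H¹(i_F)`, `H¹(i_E)`, the restriction `H¹(res; Ẑ(1)(ι))` of
  `TateModuleRestrictionKummer.lean`;
* (S1)+(S2) `completionEquiv_map_tate` (`TateModuleRestrictionCompletion.lean`) — under the Kummer
  isomorphisms that is the completion `Ψ : (Fˣ)^∧ → (Eˣ)^∧` of `Fˣ ⊆ Eˣ`;
* (S3) `completionEquiv_verlagerung` (`LocalReciprocityVerlagerung.lean`) — `e_E ∘ Ψ = Ver_{E/F} ∘ e_F`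
  (Neukirch IV (5.9));
* **`reciprocityIso_galCyclotomeRes`** — the square: `j_E (Res x) = Ver_{E/F} (j_F x)` for all
  `x ∈ H¹(G_F, μ_Ẑ(G_F))`, and **`reciprocityIso_galCyclotomeRes_induced`** — its unconditional instance for
  `φ_E` INDUCED from any `G_F`-equivariant `φ_F`.

SCOPE (honest): for the family of `cor_1_10_i_b_natural_holds` the identifications are the LCFT data
`(exists_torsionReciprocityData_levelChar k).choose.equiv`, one per field; that THOSE are compatible under
restriction (= naturality of Serre's `θ` on torsion under `E/F`, [AbsAnab] Prop. 1.2.1 (vi)/(vii)) is the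
separate lemma which, fed to `reciprocityIso_galCyclotomeRes` as `hcompat`, yields the open-injective
clause for THAT family verbatim.  Theorems only (no definition, no named fact, no `sorry`).  HONEST
FRAMING: classical LCFT/Kummer theory; nothing here bears on [IUTchIII] Cor. 3.12 or takes a side.
-/

noncomputable section

open CategoryTheory Function
open Field ValuativeRel
open ProfiniteGrp ProfiniteGrp.ProfiniteCompletion

universe u

namespace Literature.AnabelianGeometry.AbsoluteAnabelian

open _root_.TopRep _root_.ContRepresentation _root_.ContinuousCohomology
open Literature.NumberTheory.GaloisRepresentations
open Literature.NumberTheory.GaloisRepresentations.DiscreteGaloisModule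
open Literature.NumberTheory.GaloisRepresentations.LocalWeilDatum

/-! ### (S4) The cyclotome square: compatible identifications intertwine `Res` on `μ_Ẑ` with `H¹(res; Ẑ(1))` -/

section Cyclotome

variable (F E : Type u) [Field F] [CharZero F] [Field E] [CharZero E] [Algebra F E] [FiniteDimensional F E]
  (φF : muQZ (absoluteGaloisGroup F) ≃+ Additive (CommGroup.torsion (AlgebraicClosure F)ˣ))
  (hφF : ∀ (σ : absoluteGaloisGroup F) (x : muQZ (absoluteGaloisGroup F)),
    (((Additive.toMul (φF (σ • x)) : CommGroup.torsion (AlgebraicClosure F)ˣ) :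
        (AlgebraicClosure F)ˣ) : AlgebraicClosure F) =
      σ • (((Additive.toMul (φF x) : CommGroup.torsion (AlgebraicClosure F)ˣ) :
        (AlgebraicClosure F)ˣ) : AlgebraicClosure F))
  (φE : muQZ (absoluteGaloisGroup E) ≃+ Additive (CommGroup.torsion (AlgebraicClosure E)ˣ))
  (hφE : ∀ (σ : absoluteGaloisGroup E) (x : muQZ (absoluteGaloisGroup E)),
    (((Additive.toMul (φE (σ • x)) : CommGroup.torsion (AlgebraicClosure E)ˣ) :
        (AlgebraicClosure E)ˣ) : AlgebraicClosure E) =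
      σ • (((Additive.toMul (φE x) : CommGroup.torsion (AlgebraicClosure E)ˣ) :
        (AlgebraicClosure E)ˣ) : AlgebraicClosure E))
  (hcompat : ∀ z : muQZ (absoluteGaloisGroup F),
    (((Additive.toMul (φE ((muQZ.mapOfOpenEmbedding (absGaloisRestrict F E)
        (absGaloisRestrict_injective F E) (isOpen_range_absGaloisRestrict F E)).symm z)) :
        CommGroup.torsion (AlgebraicClosure E)ˣ) : (AlgebraicClosure E)ˣ) : AlgebraicClosure E) =
      absClosureEmbedding F E ((((Additive.toMul (φF z)) : CommGroup.torsion (AlgebraicClosure F)ˣ) :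
        (AlgebraicClosure F)ˣ) : AlgebraicClosure F))

include hcompat in
/-- **Compatible identifications intertwine the coefficient morphisms**: if `φ_E ∘ μ_{ℚ/ℤ}(res)⁻¹ = ι ∘ φ_F`
on `μ_{ℚ/ℤ}(G_F)`, then `μ_Ẑ(G_F)|_{G_E} → μ_Ẑ(G_E) → Ẑ(1)(Ē)` (abc-iut-w5-d201's `galCyclotomeResCoeff`,
then `toTateModule E φ_E`) is `μ_Ẑ(G_F) → Ẑ(1)(F̄) → Ẑ(1)(Ē)` (`toTateModule F φ_F`, then `ι` levelwise,
`Prop121vii.muRes`), coordinate by coordinate. [cite: MochizukiAbsTopIII2015, Cor 1.10 (i) p.42] -/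
theorem toTateModule_galCyclotomeResCoeff (m : MuZhatMod (absoluteGaloisGroup F)) (n : ℕ+) :
    ((toTateModule E φE ((galCyclotomeResCoeff F E).hom m) : ∀ n : ℕ+, MuCarrier E n) n) =
      Prop121vii.muRes F E n ((toTateModule F φF m : ∀ n : ℕ+, MuCarrier F n) n) := by
  apply muVal_injective E n
  refine Units.ext ?_
  rw [muVal_toTateModule, Prop121vii.coe_muVal_muRes, muVal_toTateModule]
  unfold levelUnit
  rw [toAdd_coe_galCyclotomeResCoeff_apply, hcompat]

variable (f : TopRep.res (absGaloisRestrict F E : absoluteGaloisGroup E →* absoluteGaloisGroup F)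
    (tateModuleMu F).toTopRep ⟶ (tateModuleMu E).toTopRep)
  (hf : ∀ (x : (muSystem F).limit) (n : ℕ+),
    ((f.hom x : (muSystem E).limit) : ∀ n : ℕ+, MuCarrier E n) n =
      Prop121vii.muRes F E n ((x : ∀ n : ℕ+, MuCarrier F n) n))

include hcompat hf in
/-- **(S4) on `H¹`**: for compatible identifications `φ_F, φ_E`, abc-iut-w5-d201's restriction
`Res : H¹(G_F, μ_Ẑ(G_F)) → H¹(G_E, μ_Ẑ(G_E))` (`galCyclotomeRes F E 1`) becomes, after `H¹(i_F)` and `H¹(i_E)`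
(`i_k = galCyclotomeIsoTateModule k φ_k`), the restriction `H¹(res; Ẑ(1)(ι))` with `Ẑ(1)`-coefficients
(any coefficient morphism `f` over `res` that is `ι` coordinatewise) — on a representing cocycle both are
`σ ↦ (ι-coordinatewise) i_F (c (res σ))`. [cite: MochizukiAbsTopIII2015, Cor 1.10 (i) p.42] -/
theorem cohomologyMap_iso_galCyclotomeRes (x : galCyclotomeH1 (absoluteGaloisGroup F)) :
    (cohomologyMap (galCyclotomeIsoTateModule E φE hφE).hom 1).hom ((galCyclotomeRes F E 1).hom x) =
      ContinuousCohomology.map (absGaloisRestrict F E) f 1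
        ((cohomologyMap (galCyclotomeIsoTateModule F φF hφF).hom 1).hom x) := by
  obtain ⟨c, rfl⟩ := oneCocycleClass_surjective _ x
  have h1 : (galCyclotomeRes F E 1).hom (oneCocycleClass _ c) =
      oneCocycleClass _ (contOneCocycles.pullback (absGaloisRestrict F E) (galCyclotomeResCoeff F E) c) :=
    map_oneCocycleClass _ _ _ c
  rw [h1, cohomologyMap_oneCocycleClass, cohomologyMap_oneCocycleClass, map_oneCocycleClass]
  congr 1
  refine Subtype.ext (ContinuousMap.ext fun σ => Subtype.ext (funext fun n => ?_))
  rw [contOneCocycles.pullback_apply, contOneCocycles.pullback_apply, contOneCocycles.pullback_apply,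
    contOneCocycles.pullback_apply, resIdHom_hom_apply, resIdHom_hom_apply, hf]
  exact toTateModule_galCyclotomeResCoeff F E φF φE hcompat _ n

end Cyclotome

/-! ### The square -/

section Square

variable (F E : Type u) [Field F] [ValuativeRel F] [TopologicalSpace F] [IsNonarchimedeanLocalField F]
  [CharZero F] [Field E] [ValuativeRel E] [TopologicalSpace E] [IsNonarchimedeanLocalField E] [CharZero E]
  [Algebra F E] [FiniteDimensional F E] [Algebra.IsSeparable F E] [ValuativeExtension F E]
  [ValuativeExtension F F] [ValuativeExtension E E]
  (φF : muQZ (absoluteGaloisGroup F) ≃+ Additive (CommGroup.torsion (AlgebraicClosure F)ˣ))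
  (hφF : ∀ (σ : absoluteGaloisGroup F) (x : muQZ (absoluteGaloisGroup F)),
    (((Additive.toMul (φF (σ • x)) : CommGroup.torsion (AlgebraicClosure F)ˣ) :
        (AlgebraicClosure F)ˣ) : AlgebraicClosure F) =
      σ • (((Additive.toMul (φF x) : CommGroup.torsion (AlgebraicClosure F)ˣ) :
        (AlgebraicClosure F)ˣ) : AlgebraicClosure F))
  (φE : muQZ (absoluteGaloisGroup E) ≃+ Additive (CommGroup.torsion (AlgebraicClosure E)ˣ))
  (hφE : ∀ (σ : absoluteGaloisGroup E) (x : muQZ (absoluteGaloisGroup E)),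
    (((Additive.toMul (φE (σ • x)) : CommGroup.torsion (AlgebraicClosure E)ˣ) :
        (AlgebraicClosure E)ˣ) : AlgebraicClosure E) =
      σ • (((Additive.toMul (φE x) : CommGroup.torsion (AlgebraicClosure E)ˣ) :
        (AlgebraicClosure E)ˣ) : AlgebraicClosure E))
  (hcompat : ∀ z : muQZ (absoluteGaloisGroup F),
    (((Additive.toMul (φE ((muQZ.mapOfOpenEmbedding (absGaloisRestrict F E)
        (absGaloisRestrict_injective F E) (isOpen_range_absGaloisRestrict F E)).symm z)) :
        CommGroup.torsion (AlgebraicClosure E)ˣ) : (AlgebraicClosure E)ˣ) : AlgebraicClosure E) =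
      absClosureEmbedding F E ((((Additive.toMul (φF z)) : CommGroup.torsion (AlgebraicClosure F)ˣ) :
        (AlgebraicClosure F)ˣ) : AlgebraicClosure F))
  {eF : completion (GrpCat.of Fˣ) ≃ₜ* absoluteGaloisGroupAbelianization F}
  (heF : ∀ u : Fˣ, eF (etaFn (GrpCat.of Fˣ) u) =
    (isReciprocitySystemE (F := F) (E := F) (isClassFieldTheory_localWeilDatum F)).theta u)
  {eE : completion (GrpCat.of Eˣ) ≃ₜ* absoluteGaloisGroupAbelianization E}
  (heE : ∀ v : Eˣ, eE (etaFn (GrpCat.of Eˣ) v) =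
    (isReciprocitySystemE (F := E) (E := E) (isClassFieldTheory_localWeilDatum E)).theta v)

include hcompat heF heE in
/-- **[AbsTopIII] Cor. 1.10 (i)(b) under an injective OPEN homomorphism — the restriction/Verlagerung
square.**  For a finite separable extension `E/F` of MLFs (characteristic `0`), cyclotome identifications
`φ_F, φ_E` compatible under restriction, and the members
`j_k = H¹(i_k) ≫ (H¹(G_k, Ẑ(1)) ≃ (kˣ)^∧) ≫ e_k` of the family of (i)(b) (abc-iut-L4-d3's expression; `e_k`
completing the canonical `θ_k`): for every `x ∈ H¹(G_F, μ_Ẑ(G_F))`,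
`j_E (Res x) = Ver_{E/F} (j_F x)` in `G_E^ab`, where `Res = galCyclotomeRes F E 1` is the map induced by the
injective open `res : G_E ↪ G_F` on the cohomology of the GROUP-THEORETIC cyclotomes (coefficients
`μ_Ẑ(G_F)|_{G_E} ⥲ μ_Ẑ(G_E)`, «unaffected by passing to an open subgroup») and `Ver_{E/F}` is the Verlagerung
`G_F^ab → G_E^ab` ([AbsAnab] p. 11).  Assembly of (S4) `cohomologyMap_iso_galCyclotomeRes`, (S1)+(S2)
`completionEquiv_map_tate`, (S3) `completionEquiv_verlagerung`.
[cite: MochizukiAbsTopIII2015, Cor 1.10 (i) p.42] -/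
theorem reciprocityIso_galCyclotomeRes (x : galCyclotomeH1 (absoluteGaloisGroup F)) :
    (((AddEquiv.mk' (continuousCohomologyEquivOfIso (galCyclotomeIsoTateModule E φE hφE) 1)
          fun a b => map_add (cohomologyMap (galCyclotomeIsoTateModule E φE hφE).hom 1).hom a b).trans
        (continuousCohomologyOneTateModuleEquivCompletion E
          (Cor110iiPrime.finiteIndex_range_powMonoidHom E))).trans
      (MulEquiv.toAdditive eE.toMulEquiv)) ((galCyclotomeRes F E 1).hom x) =
    Additive.ofMul (Literature.NumberTheory.GaloisRepresentations.verlagerung F E (Additive.toMul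
      ((((AddEquiv.mk' (continuousCohomologyEquivOfIso (galCyclotomeIsoTateModule F φF hφF) 1)
            fun a b => map_add (cohomologyMap (galCyclotomeIsoTateModule F φF hφF).hom 1).hom a b).trans
          (continuousCohomologyOneTateModuleEquivCompletion F
            (Cor110iiPrime.finiteIndex_range_powMonoidHom F))).trans
        (MulEquiv.toAdditive eF.toMulEquiv)) x))) := by
  -- the coefficient morphism over `res` and the completion of `Fˣ ⊆ Eˣ`
  obtain ⟨f, hf⟩ := exists_tateResCoeff F E
  set g : Fˣ →* Eˣ := Units.map (algebraMap F E : F →* E) with hg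
  set Ψ : completion (GrpCat.of Fˣ) →ₜ* completion (GrpCat.of Eˣ) :=
    (ProfiniteGrp.ProfiniteCompletion.lift (GrpCat.ofHom g ≫ eta (GrpCat.of Eˣ))).hom with hΨ'
  have hΨ : ∀ u : Fˣ, Ψ (etaFn (GrpCat.of Fˣ) u) =
      etaFn (GrpCat.of Eˣ) (Units.map (algebraMap F E : F →* E) u) := fun u =>
    -- Mathlib `lift_eta` on elements (abc-iut-L4-d3's `Cor110Nat.lift_comp_eta_apply`, any universe)
    ConcreteCategory.congr_hom
      (ProfiniteGrp.ProfiniteCompletion.lift_eta (GrpCat.ofHom g ≫ eta (GrpCat.of Eˣ))) u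
  change Additive.ofMul (eE (Additive.toMul (continuousCohomologyOneTateModuleEquivCompletion E
      (Cor110iiPrime.finiteIndex_range_powMonoidHom E)
      ((cohomologyMap (galCyclotomeIsoTateModule E φE hφE).hom 1).hom ((galCyclotomeRes F E 1).hom x))))) =
    Additive.ofMul (Literature.NumberTheory.GaloisRepresentations.verlagerung F E
      (eF (Additive.toMul (continuousCohomologyOneTateModuleEquivCompletion F
        (Cor110iiPrime.finiteIndex_range_powMonoidHom F)
        ((cohomologyMap (galCyclotomeIsoTateModule F φF hφF).hom 1).hom x)))))
  rw [cohomologyMap_iso_galCyclotomeRes F E φF hφF φE hφE hcompat f hf,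
    completionEquiv_map_tate (Cor110iiPrime.finiteIndex_range_powMonoidHom F)
      (Cor110iiPrime.finiteIndex_range_powMonoidHom E) f hf hΨ, toMul_ofMul,
    completionEquiv_verlagerung F E hΨ heF heE]

end Square

/-! ### The unconditional instance: `φ_E` induced from `φ_F` -/

section InducedCompat

variable (F E : Type u) [Field F] [CharZero F] [Field E] [CharZero E] [Algebra F E] [FiniteDimensional F E]
  (φF : muQZ (absoluteGaloisGroup F) ≃+ Additive (CommGroup.torsion (AlgebraicClosure F)ˣ))

/-- The identification of `μ_{ℚ/ℤ}(G_E)` INDUCED from `φ_F` (abc-iut-w5-d201's `inducedCyclotomeEquiv`) is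
compatible with `φ_F` under restriction (by construction). [cite: MochizukiAbsTopIII2015, Cor 1.10 (i) p.42] -/
theorem inducedCyclotomeEquiv_compat (z : muQZ (absoluteGaloisGroup F)) :
    (((Additive.toMul (inducedCyclotomeEquiv F E φF ((muQZ.mapOfOpenEmbedding (absGaloisRestrict F E)
        (absGaloisRestrict_injective F E) (isOpen_range_absGaloisRestrict F E)).symm z)) :
        CommGroup.torsion (AlgebraicClosure E)ˣ) : (AlgebraicClosure E)ˣ) : AlgebraicClosure E) =
      absClosureEmbedding F E ((((Additive.toMul (φF z)) : CommGroup.torsion (AlgebraicClosure F)ˣ) :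
        (AlgebraicClosure F)ˣ) : AlgebraicClosure F) := by
  rw [inducedCyclotomeEquiv_apply, AddEquiv.apply_symm_apply, coe_toMul_torsionUnitsTransport]

end InducedCompat

section Induced

variable (F E : Type u) [Field F] [ValuativeRel F] [TopologicalSpace F] [IsNonarchimedeanLocalField F]
  [CharZero F] [Field E] [ValuativeRel E] [TopologicalSpace E] [IsNonarchimedeanLocalField E] [CharZero E]
  [Algebra F E] [FiniteDimensional F E] [Algebra.IsSeparable F E] [ValuativeExtension F E]
  [ValuativeExtension F F] [ValuativeExtension E E]
  (φF : muQZ (absoluteGaloisGroup F) ≃+ Additive (CommGroup.torsion (AlgebraicClosure F)ˣ))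
  (hφF : ∀ (σ : absoluteGaloisGroup F) (x : muQZ (absoluteGaloisGroup F)),
    (((Additive.toMul (φF (σ • x)) : CommGroup.torsion (AlgebraicClosure F)ˣ) :
        (AlgebraicClosure F)ˣ) : AlgebraicClosure F) =
      σ • (((Additive.toMul (φF x) : CommGroup.torsion (AlgebraicClosure F)ˣ) :
        (AlgebraicClosure F)ˣ) : AlgebraicClosure F))

variable {eF : completion (GrpCat.of Fˣ) ≃ₜ* absoluteGaloisGroupAbelianization F}
  (heF : ∀ u : Fˣ, eF (etaFn (GrpCat.of Fˣ) u) =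
    (isReciprocitySystemE (F := F) (E := F) (isClassFieldTheory_localWeilDatum F)).theta u)
  {eE : completion (GrpCat.of Eˣ) ≃ₜ* absoluteGaloisGroupAbelianization E}
  (heE : ∀ v : Eˣ, eE (etaFn (GrpCat.of Eˣ) v) =
    (isReciprocitySystemE (F := E) (E := E) (isClassFieldTheory_localWeilDatum E)).theta v)

include heF heE in
/-- **Cor. 1.10 (i)(b), open-injective functoriality with the INDUCED identification — unconditional**:
for ANY `G_F`-equivariant `φ_F : μ_{ℚ/ℤ}(G_F) ≅ μ(F̄)` ([AbsAnab] Prop. 1.2.1 (vi)) and the identification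
`φ_E` of `μ_{ℚ/ℤ}(G_E)` induced from it along `res` (the restriction-compatible member, «by considering the
Verlagerung», [AbsAnab] p. 11), the members `j_F`, `j_E` of the (i)(b) family (canonical `e_F`, `e_E`)
satisfy `j_E (Res x) = Ver_{E/F} (j_F x)` for all `x ∈ H¹(G_F, μ_Ẑ(G_F))` — the same scope as the (O4) index
formula for (i)(a) (`GaloisCyclotomeRestrictionIndex.lean`). [cite: MochizukiAbsTopIII2015, Cor 1.10 (i) p.42] -/
theorem reciprocityIso_galCyclotomeRes_induced (x : galCyclotomeH1 (absoluteGaloisGroup F)) :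
    (((AddEquiv.mk' (continuousCohomologyEquivOfIso (galCyclotomeIsoTateModule E
            (inducedCyclotomeEquiv F E φF) (inducedCyclotomeEquiv_smul F E φF hφF)) 1)
          fun a b => map_add (cohomologyMap (galCyclotomeIsoTateModule E
            (inducedCyclotomeEquiv F E φF) (inducedCyclotomeEquiv_smul F E φF hφF)).hom 1).hom a b).trans
        (continuousCohomologyOneTateModuleEquivCompletion E
          (Cor110iiPrime.finiteIndex_range_powMonoidHom E))).trans
      (MulEquiv.toAdditive eE.toMulEquiv)) ((galCyclotomeRes F E 1).hom x) =
    Additive.ofMul (Literature.NumberTheory.GaloisRepresentations.verlagerung F E (Additive.toMul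
      ((((AddEquiv.mk' (continuousCohomologyEquivOfIso (galCyclotomeIsoTateModule F φF hφF) 1)
            fun a b => map_add (cohomologyMap (galCyclotomeIsoTateModule F φF hφF).hom 1).hom a b).trans
          (continuousCohomologyOneTateModuleEquivCompletion F
            (Cor110iiPrime.finiteIndex_range_powMonoidHom F))).trans
        (MulEquiv.toAdditive eF.toMulEquiv)) x))) :=
  reciprocityIso_galCyclotomeRes F E φF hφF (inducedCyclotomeEquiv F E φF)
    (inducedCyclotomeEquiv_smul F E φF hφF) (inducedCyclotomeEquiv_compat F E φF) heF heE x

end Induced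

end Literature.AnabelianGeometry.AbsoluteAnabelian
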